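import Summits.PneNP.PneNP.Theses.FreeHardnessEF
import Literature.Computability.Complexity.ProofComplexityProofs
import Literature.Computability.MetaComplexity.FregeImplicationalCompleteness
import Literature.Computability.Complexity.CircuitClassesUniformProofs
import Literature.Computability.Complexity.CircuitSizeProofs
import Literature.Computability.Complexity.CircuitLowerBounds

/-! # Disproof of `HardnessTransfer` (stmt-PneNP-18211, route FreeHardnessEF) — findings

Crux: `HardnessTransfer := FreeHardness → EFNotPolyBounded` where
`FreeHardness := ∀ c, ∃ L ∈ P, ∀ᶠ n, n^c < L.circuitSize n` (P ⊄ io-SIZE(n^c) for every c) and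
`EFNotPolyBounded := ∀ F, IsFrege F → ¬ F.IsEFPolyBounded` (pnp.S32, `Iff.rfl`-equal to the
conclusion). Birth attack (refuter-rattack-stmt-PneNP-18211-0, 2026-08-17): NO KILL — both sides are
open statements believed true; nothing finite to compute. What this file proves (all sorry-free):

* (a) LOAD-BEARING ANALYSIS
  - `hardnessTransferWithoutIsFrege_iff` / `transferCompleteOnly_iff`: dropping soundness of `F`
    collapses the crux to `¬ FreeHardness` (false under `¬PneNP`, `freeHardness_of_not_pneNP`) —
    soundness is load-bearing;
  - `efNotPolyBounded_iff_forall_isSound`: implicational completeness is NOT load-bearing (the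
    conclusion equals its `IsSound`-only strengthening, Cook–Reckhow Cor. 4.7 transfer in tree);
  - `transfer_iff_of_SigmaP_four_subset` (`transferEXP_iff`, `transferPH_iff`): replacing `P` in the
    hypothesis by ANY class `⊇ Σ₄ᵖ` turns the hypothesis into Kannan's a.e. theorem (in tree), so the
    mutated crux is `↔ EFNotPolyBounded`: the polynomial-time UNIFORMITY of the hard language is the
    crux's only discount on the unconditional EF lower bound S32 — any proof must consume `L ∈ P`
    (the planner's intended tt-formula / iterability pipeline, Krajíček 2019 Thm 19.5.3(ii) and
    Lemma 19.5.4, never does: an exponentially iterable P/poly map for EF already gives S32).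
* (b) CALIBRATION / restates-summit probes
  - `hardnessTransfer_of_efNotPolyBounded`: S32 → crux (crux ≤ S32);
  - `pneNP_or_freeHardness`: `PneNP ∨ FreeHardness` is a theorem, hence
    `hardnessTransfer_iff_efNotPolyBounded_of_not_pneNP`: under `¬PneNP` (the only world in which
    the glue calls the crux) the crux IS S32, and `hardnessTransfer_imp`: crux → (¬PneNP → S32);
  - `closes_with_weaker` / `weaker_of_pneNP`: the weaker `¬PneNP → S32` closes the same cut with
    `CollapseReachesEF` and is implied by the summit (necessary), unlike — as far as known — the crux;
  - C → S and S → C both fail by `exact?`/`aesop` (Scratch.lean in the seat folder): not a restatement.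
* (c) QUANTIFIER ORDER: `not_freeHardness_swapped`: `∃ L ∈ P, ∀ c, a.e. n^c < size` is FALSE
  (`P ⊆ P/poly` in tree), so the written order `∀ c ∃ L` is the meaningful one.
* (d) NON-VACUITY: `IsFrege textbookFrege` holds in tree (`isFrege_textbookFrege_holds`);
  `FreeHardness` holds under `¬PneNP` (Kannan + collapse) and is itself open unconditionally
  (no superlinear circuit lower bound for P is known), so neither hypothesis is refutable here.
* -- Targets: none yet (no line picked).
-/

set_option linter.dupNamespace false

namespace Summit.PneNP.PneNP.Cruxes.HardnessTransfer.Disproof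

open Literature.Computability.Complexity Literature.Computability.MetaComplexity Filter
open Summit.PneNP.PneNP.Theses.FreeHardnessEF

/-- The free hypothesis of the crux: `P ⊄ io-SIZE(n^c)` for every `c` (a.e. hardness). -/
def FreeHardness : Prop :=
  ∀ c : ℕ, ∃ L ∈ Classes.P, ∀ᶠ n in atTop, n ^ c < L.circuitSize n

theorem hardnessTransfer_iff : HardnessTransfer ↔ (FreeHardness → EFNotPolyBounded) := Iff.rfl

/-- S32 ⇒ crux. -/
theorem hardnessTransfer_of_efNotPolyBounded (h : EFNotPolyBounded) : HardnessTransfer :=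
  fun _ => h

/-- Under its own hypothesis the crux is S32. -/
theorem hardnessTransfer_iff_of_freeHardness (h : FreeHardness) :
    HardnessTransfer ↔ EFNotPolyBounded :=
  ⟨fun ht => ht h, fun he _ => he⟩

/-- MUTATION of the hypothesis class: for any class `C ⊇ Σ₄ᵖ` the transfer statement is
equivalent to the unconditional EF lower bound (Kannan's a.e. theorem discharges the hypothesis). -/
theorem transfer_iff_of_SigmaP_four_subset {C : Set (Language Bool)} (hC : SigmaP 4 ⊆ C) :
    ((∀ c : ℕ, ∃ L ∈ C, ∀ᶠ n in atTop, n ^ c < L.circuitSize n) → EFNotPolyBounded) ↔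
      EFNotPolyBounded :=
  ⟨fun h => h fun c =>
      (Kannan.exists_mem_SigmaP_four_eventually_lt_circuitSize c).imp fun _ hL => ⟨hC hL.1, hL.2⟩,
    fun h _ => h⟩

/-- … in particular with `EXP` (IKW 2002 Thm. 2 form, in tree). -/
theorem transferEXP_iff :
    ((∀ c : ℕ, ∃ L ∈ EXP, ∀ᶠ n in atTop, n ^ c < L.circuitSize n) → EFNotPolyBounded) ↔
      EFNotPolyBounded :=
  ⟨fun h => h exists_mem_EXP_eventually_lt_circuitSize, fun h _ => h⟩

/-- … and with `PH`. -/
theorem transferPH_iff :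
    ((∀ c : ℕ, ∃ L ∈ PH, ∀ᶠ n in atTop, n ^ c < L.circuitSize n) → EFNotPolyBounded) ↔
      EFNotPolyBounded :=
  transfer_iff_of_SigmaP_four_subset (SigmaP_subset_PH 4)

/-- So `HardnessTransfer ↔ EFNotPolyBounded` as soon as `Σ₄ᵖ ⊆ P`. -/
theorem hardnessTransfer_iff_of_SigmaP_four_subset_P (hC : SigmaP 4 ⊆ Classes.P) :
    HardnessTransfer ↔ EFNotPolyBounded :=
  transfer_iff_of_SigmaP_four_subset hC

/-- `¬ PneNP` gives `Σ₄ᵖ ⊆ P` (Cook bridge, `co P = P`, Stockmeyer collapse). -/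
theorem SigmaP_four_subset_P_of_not_pneNP (h : ¬ PneNP) : SigmaP 4 ⊆ Classes.P := by
  have hPNP : Classes.P = Nondeterministic.NP := by
    by_contra hne
    exact h (pneNP_shape_iff_P_ne_NP.2 hne)
  have hNPcoNP : Nondeterministic.NP = coNP := by
    change Nondeterministic.NP = co Nondeterministic.NP
    rw [← hPNP]
    exact co_P_holds.symm
  have hPH : PH = Nondeterministic.NP := PH_eq_NP_of_NP_eq_coNP hNPcoNP
  rw [hPNP, ← hPH]
  exact SigmaP_subset_PH 4

/-- `¬ PneNP → FreeHardness` (the glue's extraction, redone here). -/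
theorem freeHardness_of_not_pneNP (h : ¬ PneNP) : FreeHardness := fun c =>
  (Kannan.exists_mem_SigmaP_four_eventually_lt_circuitSize c).imp fun _ hL =>
    ⟨SigmaP_four_subset_P_of_not_pneNP h hL.1, hL.2⟩

/-- `PneNP ∨ FreeHardness` is a THEOREM: the free hypothesis can only fail in a world where the
summit already holds. -/
theorem pneNP_or_freeHardness : PneNP ∨ FreeHardness := by
  by_cases h : PneNP
  · exact Or.inl h
  · exact Or.inr (freeHardness_of_not_pneNP h)

/-- Under `¬ PneNP` the crux is literally S32. -/
theorem hardnessTransfer_iff_efNotPolyBounded_of_not_pneNP (h : ¬ PneNP) :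
    HardnessTransfer ↔ EFNotPolyBounded :=
  hardnessTransfer_iff_of_freeHardness (freeHardness_of_not_pneNP h)

/-- Sandwich, lower side: `HardnessTransfer → (¬PneNP → EFNotPolyBounded)`; the weaker
statement on the right already suffices for the route's assembly. -/
theorem hardnessTransfer_imp (ht : HardnessTransfer) : ¬ PneNP → EFNotPolyBounded :=
  fun h => ht (freeHardness_of_not_pneNP h)

/-- The weaker statement closes the same cut with `CollapseReachesEF`. -/
theorem closes_with_weaker (hw : ¬ PneNP → EFNotPolyBounded) (h₂ : CollapseReachesEF) : PneNP := by
  by_contra h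
  obtain ⟨F, hF, hEF⟩ := h₂ h
  exact hw h F hF hEF

/-- and is implied by the summit, i.e. it is NECESSARY (unlike, as far as known, the crux). -/
theorem weaker_of_pneNP (h : PneNP) : ¬ PneNP → EFNotPolyBounded := fun h' => absurd h h'

/-! ### Mutation of the conclusion -/

/-- Dropping `IsFrege`. -/
def HardnessTransferWithoutIsFrege : Prop :=
  FreeHardness → ∀ F : FregeSystem, ¬ F.IsEFPolyBounded

/-- The axiom scheme `⊢ A` has one-line EF-proofs of everything. -/
theorem isEFPolyBounded_anyAxiom : (⟨[⟨[], .var 0⟩]⟩ : FregeSystem).IsEFPolyBounded := by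
  refine ⟨Polynomial.X, fun φ _ => ⟨[φ], ⟨fun k hk => Or.inl ?_, rfl⟩, by simp [proofSize]⟩⟩
  have hk0 : k = 0 := by simpa using hk
  subst hk0
  exact ⟨⟨[], .var 0⟩, List.mem_singleton_self _, fun _ => φ, by simp [PropForm.subst], by simp⟩

/-- Without soundness the crux is the negation of its own hypothesis (false under `¬PneNP`):
soundness is load-bearing. -/
theorem hardnessTransferWithoutIsFrege_iff : HardnessTransferWithoutIsFrege ↔ ¬ FreeHardness :=
  ⟨fun h hf => h hf _ isEFPolyBounded_anyAxiom, fun h hf => absurd hf h⟩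

/-- Dropping only soundness (keeping completeness) fares the same (`⊢ A` is complete). -/
theorem transferCompleteOnly_iff :
    (FreeHardness → ∀ F : FregeSystem, F.IsImplicationallyComplete → ¬ F.IsEFPolyBounded) ↔
      ¬ FreeHardness :=
  ⟨fun h hf => h hf _ FregeSystem.isImplicationallyComplete_anyAxiom isEFPolyBounded_anyAxiom,
    fun h hf => absurd hf h⟩

/-- Dropping only implicational completeness changes nothing: the conclusion is equivalent to
its `IsSound`-only strengthening (Cook–Reckhow Cor. 4.7 transfer, in tree). -/
theorem efNotPolyBounded_iff_forall_isSound :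
    EFNotPolyBounded ↔ ∀ F : FregeSystem, F.IsSound → ¬ F.IsEFPolyBounded :=
  ⟨fun h _ hF hEF => h textbookFrege isFrege_textbookFrege_holds
      (hEF.of_isImplicationallyComplete isFrege_textbookFrege_holds.2 hF),
    fun h F hF => h F hF.1⟩

/-- Non-vacuity of the `∀ F, IsFrege F → …` binder: a genuine Frege system exists in tree. -/
example : ∃ F, IsFrege F := ⟨textbookFrege, isFrege_textbookFrege_holds⟩

/-! ### Quantifier order of the hypothesis -/

/-- A polynomial over `ℕ` is eventually STRICTLY below `n^(deg+2)`. [folklore] -/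
theorem eventually_eval_lt_pow (p : Polynomial ℕ) :
    ∀ᶠ n : ℕ in atTop, p.eval n < n ^ (p.natDegree + 2) := by
  filter_upwards [eventually_ge_atTop (p.eval 1 + 2)] with n hn
  have h1 : 1 ≤ n := by omega
  calc p.eval n ≤ p.eval 1 * n ^ p.natDegree := natPoly_eval_le_eval_one_mul_pow p h1
    _ < n * n ^ p.natDegree := by
        apply Nat.mul_lt_mul_of_lt_of_le (by omega) le_rfl (Nat.one_le_pow _ _ h1)
    _ ≤ n * n * n ^ p.natDegree := by
        exact Nat.mul_le_mul_right _ (Nat.le_mul_of_pos_left n (by omega))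
    _ = n ^ (p.natDegree + 2) := by ring

/-- The quantifier-SWAPPED hypothesis `∃ L ∈ P, ∀ c, a.e. n^c < size` is FALSE (`P ⊆ P/poly`, in
tree): the order `∀ c ∃ L` of the crux is the meaningful one, and the swapped crux would be
trivially true. -/
theorem not_freeHardness_swapped :
    ¬ ∃ L ∈ Classes.P, ∀ c : ℕ, ∀ᶠ n in atTop, n ^ c < L.circuitSize n := by
  rintro ⟨L, hL, hc⟩
  obtain ⟨p, hp⟩ := Set.mem_iUnion.1 (P_subset_PPoly_holds hL)
  have hle : ∀ n, L.circuitSize n ≤ p.eval n := (mem_SIZE_iff_circuitSize_le_holds L _).1 hp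
  obtain ⟨n, hn1, hn2⟩ := ((hc (p.natDegree + 2)).and (eventually_eval_lt_pow p)).exists
  exact absurd ((hle n).trans_lt hn2) (not_lt.2 hn1.le)

end Summit.PneNP.PneNP.Cruxes.HardnessTransfer.Disproof
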